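import Mathlib

/-!
# Substitutions `f(X) ↦ f(A X B)`, torus weights and initial forms on `𝔽[X_{n×m}]`

Support file (definitions with bodies + proved lemmas, no named facts) for the proof of
Andrews–Forbes 2022, Proposition 3.5 (`BideterminantReduction.lean`; proof in
`BideterminantReductionProofs.lean`). The proof in the tree replaces the straightening-law
bookkeeping of the printed proof (loc. cit. §3.1, Lemma 3.4) by highest-weight theory for the
action `f(X) ↦ f(A X B)` of `GL_n(𝔽) × GL_m(𝔽)` on `𝔽[X]`, `X` the generic `n × m` matrix. This file
supplies the elementary toolkit:

* `AndrewsForbes.ev M` — evaluation `f ↦ f(M)` of `f ∈ 𝔽[X]` at a matrix `M` with entries in a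
  commutative `𝔽`-algebra (an `𝔽`-algebra map); composition and naturality
  (`ev_ev`, `map_ev`); `AndrewsForbes.transl A B f = f(A X B)`.
* torus weights of a monomial `X^e`: `rowWt e` (row sums of the exponent matrix), `colWt e`;
  the scaling rules `f(diag(a) M) = a^{rowWt} f(M)` on polynomials of pure row weight
  (`ev_rowScale_of_rowWt_eq`), and the value of a translate by diagonal matrices on monomials.
* `AndrewsForbes.twist w f ∈ 𝔽[X][t]` — the one-parameter torus family `∑_e f_e t^{⟨w,e⟩} X^e`
  (`w = u_i + v_j`): its `t^q`-coefficient is the `w`-initial part of `f`, its value at `t = t₀` is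
  the translate `f(diag(t₀^u) X diag(t₀^v))` (this is the `(D+1)`-adic scaling
  `x_{i,j} ↦ y^{(D+1)^i} z^{(D+1)^j} x_{i,j}` of the printed proof of Prop. 3.5, p. 21);
  `apply_coeff_eq_zero_of_forall_eval` — over an infinite field a linear functional killing all
  values `P(t₀)`, `t₀ ≠ 0`, kills every coefficient of `P`.
* `AndrewsForbes.eq_of_filtered` — an algebra endomorphism moving each variable only by terms of
  smaller `w`-weight fixes a `w`-homogeneous `f` as soon as it does not lower the weights of `f`
  (used for the unipotent invariance of extremal weight components).
* `AndrewsForbes.digits_injective` / `rowWt_eq_of_weight_eq` — `(D+2)`-adic digits separate weights.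
* `AndrewsForbes.totalDegree_ev_le` — linear substitutions do not raise the total degree.
* `AndrewsForbes.ev_lower_mul_mul_upper_eq_of_forall` — an identity `f(L X U) = f(X)` valid for all
  unitriangular `L, U` with entries in the (infinite) field `𝔽` stays valid for unitriangular
  matrices over any commutative `𝔽`-algebra (polynomial identities, `MvPolynomial.funext`).

## References

* R. Andrews, M. A. Forbes, arXiv:2112.00792, §3.1 (proof of Prop. 3.5: the scaling step and
  Lemma 2.x "approximate leading coefficients"). [`AndrewsForbes2022`]
* Highest-weight vectors / torus weights for `GL_n`: Fulton–Harris GTM 129 §15.3; the tree's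
  `Literature.NumberTheory.DiophantineGeometry.GLHighestWeight`. [folklore]
-/

noncomputable section

namespace Literature.Computability.AlgebraicComplexity.AndrewsForbes

open MvPolynomial Matrix

variable {F : Type*} [Field F] {n m : ℕ}

/-! ### Evaluation of `f ∈ 𝔽[X]` at a matrix -/

section Ev

variable {S : Type*} [CommRing S] [Algebra F S]

/-- Evaluation `f ↦ f(M)` of a polynomial in the entries of the generic `n × m` matrix at a matrix
`M` with entries in a commutative `𝔽`-algebra `S` (Mathlib's `MvPolynomial.aeval` at the entries).
[folklore] -/
def ev (M : Matrix (Fin n) (Fin m) S) : MvPolynomial (Fin n × Fin m) F →ₐ[F] S :=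
  MvPolynomial.aeval fun ij => M ij.1 ij.2

/-- `ev M (X (i,j)) = M i j`. [folklore] -/
@[simp]
theorem ev_X (M : Matrix (Fin n) (Fin m) S) (ij : Fin n × Fin m) :
    ev (F := F) M (X ij) = M ij.1 ij.2 := by
  simp [ev]

/-- `ev M (C a) = a`. [folklore] -/
@[simp]
theorem ev_C (M : Matrix (Fin n) (Fin m) S) (a : F) :
    ev M (C a) = algebraMap F S a := by
  simp [ev]

/-- The generic matrix mapped entrywise by `ev M` is `M`. [folklore] -/
@[simp]
theorem mvPolynomialX_map_ev (M : Matrix (Fin n) (Fin m) S) :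
    (mvPolynomialX (Fin n) (Fin m) F).map (ev M) = M := by
  ext i j
  simp [ev]

/-- A numerical matrix, pushed into `𝔽[X]` by `C` and then evaluated, is itself. [folklore] -/
@[simp]
theorem map_C_map_ev {ι κ : Type*} (M : Matrix (Fin n) (Fin m) S) (A : Matrix ι κ F) :
    (A.map (C : F → MvPolynomial (Fin n × Fin m) F)).map (ev M) = A.map (algebraMap F S) := by
  ext i j
  simp

/-- Evaluation at the generic matrix is the identity. [folklore] -/
@[simp]
theorem ev_mvPolynomialX (p : MvPolynomial (Fin n × Fin m) F) :
    ev (mvPolynomialX (Fin n) (Fin m) F) p = p := by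
  have : ev (F := F) (mvPolynomialX (Fin n) (Fin m) F) = AlgHom.id F _ := by
    refine MvPolynomial.algHom_ext fun ij => ?_
    simp [ev]
  rw [this, AlgHom.id_apply]

/-- **Naturality.** An `𝔽`-algebra map applied after evaluation is evaluation at the mapped matrix.
[folklore] -/
theorem map_ev {S' : Type*} [CommRing S'] [Algebra F S'] (ψ : S →ₐ[F] S')
    (M : Matrix (Fin n) (Fin m) S) (p : MvPolynomial (Fin n × Fin m) F) :
    ψ (ev M p) = ev (M.map ψ) p := by
  have h := MvPolynomial.comp_aeval (R := F) ψ (f := fun ij : Fin n × Fin m => M ij.1 ij.2)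
  have := congrArg (fun φ => φ p) h
  simpa [ev] using this

/-- **Composition of substitutions**: `(f(M'))(M) = f(M'(M))`. [folklore] -/
theorem ev_ev (M : Matrix (Fin n) (Fin m) S)
    (M' : Matrix (Fin n) (Fin m) (MvPolynomial (Fin n × Fin m) F))
    (p : MvPolynomial (Fin n × Fin m) F) :
    ev M (ev M' p) = ev (M'.map (ev M)) p :=
  map_ev (ev M) M' p

/-- Evaluation at a numerical matrix is `MvPolynomial.eval`. [folklore] -/
theorem ev_eq_eval (M : Matrix (Fin n) (Fin m) F) (p : MvPolynomial (Fin n × Fin m) F) :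
    ev M p = MvPolynomial.eval (fun ij => M ij.1 ij.2) p := by
  simp [ev]

/-- A ring map applied entrywise to a triple product. [folklore] -/
theorem map_mul_mul {α β ι κ τ υ Φ : Type*} [Fintype κ] [Fintype τ] [NonAssocSemiring α]
    [NonAssocSemiring β] [FunLike Φ α β] [RingHomClass Φ α β]
    (f : Φ) (A : Matrix ι κ α) (B : Matrix κ τ α) (D : Matrix τ υ α) :
    (A * B * D).map f = A.map f * B.map f * D.map f := by
  ext i j
  simp [Matrix.mul_apply, map_sum, map_mul, Finset.sum_mul]

/-- Evaluation commutes with minors: `ev M (det X_{ρ,γ}) = det M_{ρ,γ}`. [folklore] -/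
theorem ev_det_submatrix {k : ℕ} (M : Matrix (Fin n) (Fin m) S) (ρ : Fin k → Fin n)
    (γ : Fin k → Fin m) :
    ev M ((mvPolynomialX (Fin n) (Fin m) F).submatrix ρ γ).det = (M.submatrix ρ γ).det := by
  rw [AlgHom.map_det]
  congr 1
  ext i j
  simp [AlgHom.mapMatrix_apply]

end Ev

/-! ### Two-sided translates `f(A X B)` -/

section Transl

/-- The translate `f ↦ f(A X B)` by numerical square matrices `A` (`n × n`) and `B` (`m × m`): the
action of `Mat_n × Mat_m` (in particular of `GL_n × GL_m`) on `𝔽[X]` used throughout §3.1 of the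
source ("`f(M X N)`"). [cite: AndrewsForbes2022, §3.1 (Lemma 3.4, Prop. 3.5)] -/
def transl (A : Matrix (Fin n) (Fin n) F) (B : Matrix (Fin m) (Fin m) F) :
    MvPolynomial (Fin n × Fin m) F →ₐ[F] MvPolynomial (Fin n × Fin m) F :=
  ev ((A.map C : Matrix (Fin n) (Fin n) (MvPolynomial (Fin n × Fin m) F)) *
    mvPolynomialX (Fin n) (Fin m) F * (B.map C : Matrix (Fin m) (Fin m) (MvPolynomial (Fin n × Fin m) F)))

/-- Unfolding `transl`. [folklore] -/
theorem transl_apply (A : Matrix (Fin n) (Fin n) F) (B : Matrix (Fin m) (Fin m) F)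
    (p : MvPolynomial (Fin n × Fin m) F) :
    transl A B p = ev ((A.map C : Matrix (Fin n) (Fin n) (MvPolynomial (Fin n × Fin m) F)) *
      mvPolynomialX (Fin n) (Fin m) F *
      (B.map C : Matrix (Fin m) (Fin m) (MvPolynomial (Fin n × Fin m) F))) p := rfl

/-- Evaluating a translate: `(f(AXB))(M) = f(A M B)`. [folklore] -/
theorem ev_transl {S : Type*} [CommRing S] [Algebra F S] (M : Matrix (Fin n) (Fin m) S)
    (A : Matrix (Fin n) (Fin n) F) (B : Matrix (Fin m) (Fin m) F)
    (p : MvPolynomial (Fin n × Fin m) F) :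
    ev M (transl A B p) = ev (A.map (algebraMap F S) * M * B.map (algebraMap F S)) p := by
  rw [transl_apply, ev_ev, map_mul_mul, map_C_map_ev, mvPolynomialX_map_ev, map_C_map_ev]

/-- Translates compose: `(f(A'XB'))(AXB) = f(A'A X B B')`. [folklore] -/
theorem transl_transl (A A' : Matrix (Fin n) (Fin n) F) (B B' : Matrix (Fin m) (Fin m) F)
    (p : MvPolynomial (Fin n × Fin m) F) :
    transl A B (transl A' B' p) = transl (A' * A) (B * B') p := by
  have hmat : A'.map (algebraMap F (MvPolynomial (Fin n × Fin m) F)) *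
      ((A.map C : Matrix (Fin n) (Fin n) (MvPolynomial (Fin n × Fin m) F)) *
        mvPolynomialX (Fin n) (Fin m) F *
        (B.map C : Matrix (Fin m) (Fin m) (MvPolynomial (Fin n × Fin m) F))) *
      B'.map (algebraMap F (MvPolynomial (Fin n × Fin m) F)) =
      ((A' * A).map C : Matrix (Fin n) (Fin n) (MvPolynomial (Fin n × Fin m) F)) *
        mvPolynomialX (Fin n) (Fin m) F *
        ((B * B').map C : Matrix (Fin m) (Fin m) (MvPolynomial (Fin n × Fin m) F)) := by
    rw [MvPolynomial.algebraMap_eq]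
    simp only [Matrix.map_mul, Matrix.mul_assoc]
  rw [transl_apply A B, ev_transl, hmat, ← transl_apply]

/-- The trivial translate. [folklore] -/
@[simp]
theorem transl_one_one (p : MvPolynomial (Fin n × Fin m) F) : transl 1 1 p = p := by
  rw [transl_apply]
  simp

end Transl

/-! ### Torus weights -/

section Weights

/-- Row weight of an exponent matrix `e` (the `GL_n`-torus weight of the monomial `X^e`): its row
sums. [folklore] -/
def rowWt (e : Fin n × Fin m →₀ ℕ) : Fin n → ℕ := fun i => ∑ j, e (i, j)

/-- Column weight of an exponent matrix `e` (the `GL_m`-torus weight of `X^e`): its column sums.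
[folklore] -/
def colWt (e : Fin n × Fin m →₀ ℕ) : Fin m → ℕ := fun j => ∑ i, e (i, j)

/-- Unfolding `rowWt`. [folklore] -/
theorem rowWt_apply (e : Fin n × Fin m →₀ ℕ) (i : Fin n) : rowWt e i = ∑ j, e (i, j) := rfl

/-- Unfolding `colWt`. [folklore] -/
theorem colWt_apply (e : Fin n × Fin m →₀ ℕ) (j : Fin m) : colWt e j = ∑ i, e (i, j) := rfl

/-- The weight of `e` for `w(i,j) = u i + v j` splits as `⟨u, rowWt e⟩ + ⟨v, colWt e⟩`. [folklore] -/
theorem weight_add_eq (u : Fin n → ℕ) (v : Fin m → ℕ) (e : Fin n × Fin m →₀ ℕ) :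
    Finsupp.weight (fun ij : Fin n × Fin m => u ij.1 + v ij.2) e =
      ∑ i, rowWt e i * u i + ∑ j, colWt e j * v j := by
  rw [Finsupp.weight_apply, Finsupp.sum_fintype _ _ (by simp)]
  simp only [smul_eq_mul, mul_add, Finset.sum_add_distrib, rowWt, colWt, Finset.sum_mul]
  congr 1
  · rw [Fintype.sum_prod_type]
  · rw [Fintype.sum_prod_type_right]

/-- The degree of a monomial dominates each row weight. [folklore] -/
theorem rowWt_le_degree (e : Fin n × Fin m →₀ ℕ) (i : Fin n) : rowWt e i ≤ e.degree := by
  rw [rowWt, Finsupp.degree_eq_sum, Fintype.sum_prod_type]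
  exact Finset.single_le_sum (f := fun i => ∑ j, e (i, j)) (fun _ _ => Nat.zero_le _)
    (Finset.mem_univ i)

/-- The degree of a monomial dominates each column weight. [folklore] -/
theorem colWt_le_degree (e : Fin n × Fin m →₀ ℕ) (j : Fin m) : colWt e j ≤ e.degree := by
  rw [colWt, Finsupp.degree_eq_sum, Fintype.sum_prod_type_right]
  exact Finset.single_le_sum (f := fun j => ∑ i, e (i, j)) (fun _ _ => Nat.zero_le _)
    (Finset.mem_univ j)

variable {S : Type*} [CommRing S] [Algebra F S]

/-- Evaluation of a monomial: `ev M (c X^e) = c ∏ M_{ij}^{e_{ij}}`. [folklore] -/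
theorem ev_monomial (M : Matrix (Fin n) (Fin m) S) (e : Fin n × Fin m →₀ ℕ) (c : F) :
    ev M (monomial e c) = algebraMap F S c * ∏ ij, M ij.1 ij.2 ^ e ij := by
  rw [ev, aeval_monomial, Finsupp.prod_fintype _ _ (by simp)]

/-- `∏_{ij} a_i^{e_{ij}} = ∏_i a_i^{rowWt e i}`. [folklore] -/
theorem prod_pow_fst {M : Type*} [CommMonoid M] (a : Fin n → M) (e : Fin n × Fin m →₀ ℕ) :
    ∏ ij : Fin n × Fin m, a ij.1 ^ e ij = ∏ i, a i ^ rowWt e i := by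
  rw [Fintype.prod_prod_type]
  exact Finset.prod_congr rfl fun i _ => by
    dsimp only
    rw [rowWt, Finset.prod_pow_eq_pow_sum]

/-- `∏_{ij} b_j^{e_{ij}} = ∏_j b_j^{colWt e j}`. [folklore] -/
theorem prod_pow_snd {M : Type*} [CommMonoid M] (b : Fin m → M) (e : Fin n × Fin m →₀ ℕ) :
    ∏ ij : Fin n × Fin m, b ij.2 ^ e ij = ∏ j, b j ^ colWt e j := by
  rw [Fintype.prod_prod_type_right]
  exact Finset.prod_congr rfl fun j _ => by
    dsimp only
    rw [colWt, Finset.prod_pow_eq_pow_sum]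

/-- Row scaling of a monomial value: `∏ (a_i g_{ij})^{e_{ij}} = a^{rowWt e} ∏ g_{ij}^{e_{ij}}`.
[folklore] -/
theorem prod_rowScale_pow {M : Type*} [CommMonoid M] (a : Fin n → M) (g : Fin n × Fin m → M)
    (e : Fin n × Fin m →₀ ℕ) :
    ∏ ij : Fin n × Fin m, (a ij.1 * g ij) ^ e ij =
      (∏ i, a i ^ rowWt e i) * ∏ ij : Fin n × Fin m, g ij ^ e ij := by
  simp only [mul_pow, Finset.prod_mul_distrib, prod_pow_fst]

/-- The full monomial `∏_{ij} X_{ij}^{e_{ij}}` is `monomial e 1`. [folklore] -/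
theorem prod_X_pow_univ (e : Fin n × Fin m →₀ ℕ) :
    (∏ ij : Fin n × Fin m, (X ij : MvPolynomial (Fin n × Fin m) F) ^ e ij) = monomial e 1 := by
  rw [← MvPolynomial.prod_X_pow_eq_monomial]
  exact (Finset.prod_subset (Finset.subset_univ _) fun x _ hx => by
    rw [Finsupp.notMem_support_iff.mp hx, pow_zero]).symm

/-- **Row scaling of a weight vector.** If every monomial of `p` has row weight `μ`, then
`p(diag(a) M) = a^μ · p(M)`. [folklore] -/
theorem ev_rowScale_of_rowWt_eq (a : Fin n → S) (M : Matrix (Fin n) (Fin m) S)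
    (p : MvPolynomial (Fin n × Fin m) F) (μ : Fin n → ℕ) (hp : ∀ e ∈ p.support, rowWt e = μ) :
    ev (Matrix.of fun i j => a i * M i j) p = (∏ i, a i ^ μ i) * ev M p := by
  conv_lhs => rw [p.as_sum]
  conv_rhs => rw [p.as_sum]
  rw [map_sum, map_sum, Finset.mul_sum]
  refine Finset.sum_congr rfl fun e he => ?_
  rw [ev_monomial, ev_monomial, ← hp e he]
  simp only [Matrix.of_apply]
  rw [prod_rowScale_pow a (fun ij => M ij.1 ij.2) e]
  ring

/-- The translate of a monomial by diagonal matrices: `X^e(diag(a) X diag(b)) = a^{rowWt} b^{colWt} X^e`.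
[folklore] -/
theorem transl_diagonal_monomial (a : Fin n → F) (b : Fin m → F) (e : Fin n × Fin m →₀ ℕ) (c : F) :
    transl (diagonal a) (diagonal b) (monomial e c) =
      monomial e (c * (∏ i, a i ^ rowWt e i) * ∏ j, b j ^ colWt e j) := by
  rw [transl_apply, ev_monomial]
  have hentry : ∀ ij : Fin n × Fin m,
      (((diagonal a).map C : Matrix (Fin n) (Fin n) (MvPolynomial (Fin n × Fin m) F)) *
        mvPolynomialX (Fin n) (Fin m) F *
        ((diagonal b).map C : Matrix (Fin m) (Fin m) (MvPolynomial (Fin n × Fin m) F))) ij.1 ij.2 =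
        C (a ij.1 * b ij.2) * X ij := by
    intro ij
    rw [Matrix.diagonal_map (map_zero C), Matrix.diagonal_map (map_zero C), Matrix.mul_diagonal,
      Matrix.diagonal_mul, mvPolynomialX_apply, map_mul]
    ring
  have hprod : ∏ ij : Fin n × Fin m, (C (a ij.1 * b ij.2) * (X ij : MvPolynomial (Fin n × Fin m) F)) ^ e ij
      = C ((∏ i, a i ^ rowWt e i) * ∏ j, b j ^ colWt e j) * monomial e 1 := by
    simp only [mul_pow, Finset.prod_mul_distrib, prod_X_pow_univ]
    congr 1
    rw [← prod_pow_fst, ← prod_pow_snd, ← Finset.prod_mul_distrib, map_prod]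
    exact Finset.prod_congr rfl fun ij _ => by rw [← mul_pow, map_pow]
  simp only [hentry]
  rw [hprod, MvPolynomial.algebraMap_eq, ← mul_assoc, ← map_mul, C_mul_monomial, mul_one]
  congr 1
  ring

end Weights

/-! ### The one-parameter torus family `∑ f_e t^{⟨w,e⟩} X^e` -/

section Twist

/-- The torus family of `p` for integer weights `w` on the variables: the polynomial
`∑_e p_e · t^{⟨w, e⟩} · X^e ∈ 𝔽[X][t]`, i.e. `p(…, t^{w_{ij}} x_{ij}, …)`. For `w(i,j) = u_i + v_j` its
value at `t = t₀` is the translate `p(diag(t₀^u) X diag(t₀^v))` and its lowest coefficient is the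
`w`-initial form of `p` — the scaling device of the printed proof of Prop. 3.5
(`x_{i,j} ↦ y^{(D+1)^i} z^{(D+1)^j} x_{i,j}`, then `y, z ↦ ε^d`). [cite: AndrewsForbes2022, §3.1 (proof of Prop. 3.5)] -/
def twist (w : Fin n × Fin m → ℕ) (p : MvPolynomial (Fin n × Fin m) F) :
    Polynomial (MvPolynomial (Fin n × Fin m) F) :=
  ∑ e ∈ p.support, Polynomial.monomial (Finsupp.weight w e) (monomial e (coeff e p))

/-- Coefficients of the torus family: the `t^q`-coefficient collects the monomials of weight `q`.
[folklore] -/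
theorem coeff_coeff_twist (w : Fin n × Fin m → ℕ) (p : MvPolynomial (Fin n × Fin m) F) (q : ℕ)
    (e : Fin n × Fin m →₀ ℕ) :
    coeff e ((twist w p).coeff q) = if Finsupp.weight w e = q then coeff e p else 0 := by
  classical
  rw [twist, Polynomial.finsetSum_coeff, MvPolynomial.coeff_sum]
  simp only [Polynomial.coeff_monomial, apply_ite (coeff e), coeff_zero, coeff_monomial]
  rw [Finset.sum_eq_single e]
  · by_cases hq : Finsupp.weight w e = q
    · simp [hq]
    · simp [hq]
  · intro e' _ hne
    simp [hne]
  · intro he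
    have : coeff e p = 0 := by simpa [mem_support_iff] using he
    simp [this]

/-- The support of a coefficient of the torus family lies in the support of `p`, on the
corresponding weight stratum. [folklore] -/
theorem mem_support_coeff_twist {w : Fin n × Fin m → ℕ} {p : MvPolynomial (Fin n × Fin m) F}
    {q : ℕ} {e : Fin n × Fin m →₀ ℕ} (he : e ∈ ((twist w p).coeff q).support) :
    e ∈ p.support ∧ Finsupp.weight w e = q := by
  rw [mem_support_iff, coeff_coeff_twist] at he
  by_cases h : Finsupp.weight w e = q
  · rw [if_pos h] at he
    exact ⟨mem_support_iff.mpr he, h⟩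
  · rw [if_neg h] at he
    exact absurd rfl he

/-- Value of the torus family at `t = t₀ ∈ 𝔽`: the translate by the diagonal matrices
`diag(t₀^{u})`, `diag(t₀^{v})` when `w(i,j) = u_i + v_j`. [cite: AndrewsForbes2022, §3.1 (proof of Prop. 3.5)] -/
theorem eval_twist (u : Fin n → ℕ) (v : Fin m → ℕ) (p : MvPolynomial (Fin n × Fin m) F) (t₀ : F) :
    (twist (fun ij : Fin n × Fin m => u ij.1 + v ij.2) p).eval (C t₀) =
      transl (diagonal fun i => t₀ ^ u i) (diagonal fun j => t₀ ^ v j) p := by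
  conv_rhs => rw [p.as_sum]
  rw [twist, Polynomial.eval_finsetSum, map_sum]
  refine Finset.sum_congr rfl fun e _ => ?_
  rw [Polynomial.eval_monomial, transl_diagonal_monomial, mul_comm, ← C_pow, C_mul_monomial]
  congr 1
  have h1 : t₀ ^ (∑ i, rowWt e i * u i) = ∏ i, (t₀ ^ u i) ^ rowWt e i := by
    rw [← Finset.prod_pow_eq_pow_sum]
    exact Finset.prod_congr rfl fun i _ => by ring
  have h2 : t₀ ^ (∑ j, colWt e j * v j) = ∏ j, (t₀ ^ v j) ^ colWt e j := by
    rw [← Finset.prod_pow_eq_pow_sum]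
    exact Finset.prod_congr rfl fun j _ => by ring
  rw [weight_add_eq, pow_add, h1, h2]
  ring

/-- **Coefficients from values.** Over an infinite field, an `𝔽`-linear functional on `𝔽[X]` that
kills the value of `P ∈ 𝔽[X][t]` at every nonzero `t₀ ∈ 𝔽` kills every coefficient of `P`
(a polynomial over `𝔽` with infinitely many roots vanishes). [folklore] -/
theorem apply_coeff_eq_zero_of_forall_eval [Infinite F] (P : Polynomial (MvPolynomial (Fin n × Fin m) F))
    (φ : MvPolynomial (Fin n × Fin m) F →ₗ[F] F)
    (h : ∀ t₀ : F, t₀ ≠ 0 → φ (P.eval (C t₀)) = 0) (q : ℕ) : φ (P.coeff q) = 0 := by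
  classical
  -- the scalar polynomial `Q(t) = ∑ φ(P_k) t^k`
  set Q : Polynomial F := ∑ k ∈ P.support, Polynomial.monomial k (φ (P.coeff k)) with hQ
  have hQeval : ∀ t₀ : F, Q.eval t₀ = φ (P.eval (C t₀)) := by
    intro t₀
    rw [hQ, Polynomial.eval_finsetSum, Polynomial.eval_eq_sum, Polynomial.sum, map_sum]
    refine Finset.sum_congr rfl fun k _ => ?_
    rw [Polynomial.eval_monomial, ← C_pow, mul_comm (P.coeff k), ← smul_eq_C_mul, map_smul,
      smul_eq_mul, mul_comm]
  have hQzero : Q = 0 := by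
    apply Polynomial.eq_zero_of_infinite_isRoot
    apply Set.Infinite.mono (s := {t₀ : F | t₀ ≠ 0})
    · intro t₀ ht₀
      simp only [Set.mem_setOf_eq, Polynomial.IsRoot.def, hQeval]
      exact h t₀ ht₀
    · exact (Set.finite_singleton (0 : F)).infinite_compl
  have hcoeff : Q.coeff q = φ (P.coeff q) := by
    rw [hQ, Polynomial.finsetSum_coeff]
    simp only [Polynomial.coeff_monomial]
    by_cases hq : q ∈ P.support
    · rw [Finset.sum_eq_single q]
      · rw [if_pos rfl]
      · intro k _ hk
        rw [if_neg hk]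
      · intro h'
        exact absurd hq h'
    · rw [Finset.sum_eq_zero]
      · have : P.coeff q = 0 := by simpa [Polynomial.mem_support_iff] using hq
        rw [this, map_zero]
      · intro k hk
        rw [if_neg]
        rintro rfl
        exact hq hk
  rw [← hcoeff, hQzero, Polynomial.coeff_zero]

/-- Mapping the torus family coefficientwise by an algebra endomorphism and then evaluating at
`t₀` is the endomorphism applied to the value at `t₀`. [folklore] -/
theorem eval_map_twist (θ : MvPolynomial (Fin n × Fin m) F →ₐ[F] MvPolynomial (Fin n × Fin m) F)
    (P : Polynomial (MvPolynomial (Fin n × Fin m) F)) (t₀ : F) :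
    (P.map (θ : MvPolynomial (Fin n × Fin m) F →+* MvPolynomial (Fin n × Fin m) F)).eval (C t₀) =
      θ (P.eval (C t₀)) := by
  have hC : (θ : MvPolynomial (Fin n × Fin m) F →+* MvPolynomial (Fin n × Fin m) F) (C t₀) = C t₀ :=
    θ.commutes t₀
  rw [Polynomial.eval_map]
  conv_lhs => rw [← hC]
  rw [Polynomial.eval₂_hom]
  rfl

end Twist

/-! ### Filtered substitutions fix homogeneous elements of extremal weight -/

section Filtered

variable (F) in
/-- The polynomials whose monomials all have `w`-weight `< d`. [folklore] -/
def lowerPart (w : Fin n × Fin m → ℕ) (d : ℕ) : Submodule F (MvPolynomial (Fin n × Fin m) F) :=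
  restrictSupport F {e | Finsupp.weight w e < d}

variable (F) in
/-- The polynomials whose monomials all have `w`-weight `≤ d`. [folklore] -/
def lowerEqPart (w : Fin n × Fin m → ℕ) (d : ℕ) : Submodule F (MvPolynomial (Fin n × Fin m) F) :=
  restrictSupport F {e | Finsupp.weight w e ≤ d}

variable {w : Fin n × Fin m → ℕ}

/-- Membership in `lowerPart`. [folklore] -/
theorem mem_lowerPart_iff {d : ℕ} {p : MvPolynomial (Fin n × Fin m) F} :
    p ∈ lowerPart F w d ↔ ∀ e ∈ p.support, Finsupp.weight w e < d := by
  rw [lowerPart, mem_restrictSupport_iff]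
  exact ⟨fun h e he => h he, fun h e he => h e he⟩

/-- Membership in `lowerEqPart`. [folklore] -/
theorem mem_lowerEqPart_iff {d : ℕ} {p : MvPolynomial (Fin n × Fin m) F} :
    p ∈ lowerEqPart F w d ↔ ∀ e ∈ p.support, Finsupp.weight w e ≤ d := by
  rw [lowerEqPart, mem_restrictSupport_iff]
  exact ⟨fun h e he => h he, fun h e he => h e he⟩

/-- Products: `(weight < d) · (weight ≤ d') ⊆ (weight < d + d')`. [folklore] -/
theorem mul_mem_lowerPart_of_lt_of_le {d d' : ℕ} {p q : MvPolynomial (Fin n × Fin m) F}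
    (hp : p ∈ lowerPart F w d) (hq : q ∈ lowerEqPart F w d') : p * q ∈ lowerPart F w (d + d') := by
  classical
  rw [mem_lowerPart_iff] at hp ⊢
  rw [mem_lowerEqPart_iff] at hq
  intro e he
  obtain ⟨e₁, he₁, e₂, he₂, rfl⟩ := Finset.mem_add.mp (MvPolynomial.support_mul p q he)
  rw [map_add]
  exact add_lt_add_of_lt_of_le (hp e₁ he₁) (hq e₂ he₂)

/-- Products: `(weight ≤ d) · (weight < d') ⊆ (weight < d + d')`. [folklore] -/
theorem mul_mem_lowerPart_of_le_of_lt {d d' : ℕ} {p q : MvPolynomial (Fin n × Fin m) F}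
    (hp : p ∈ lowerEqPart F w d) (hq : q ∈ lowerPart F w d') : p * q ∈ lowerPart F w (d + d') := by
  rw [mul_comm, add_comm]
  exact mul_mem_lowerPart_of_lt_of_le hq hp

/-- Products: `(weight ≤ d) · (weight ≤ d') ⊆ (weight ≤ d + d')`. [folklore] -/
theorem mul_mem_lowerEqPart {d d' : ℕ} {p q : MvPolynomial (Fin n × Fin m) F}
    (hp : p ∈ lowerEqPart F w d) (hq : q ∈ lowerEqPart F w d') : p * q ∈ lowerEqPart F w (d + d') := by
  classical
  rw [mem_lowerEqPart_iff] at hp hq ⊢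
  intro e he
  obtain ⟨e₁, he₁, e₂, he₂, rfl⟩ := Finset.mem_add.mp (MvPolynomial.support_mul p q he)
  rw [map_add]
  exact add_le_add (hp e₁ he₁) (hq e₂ he₂)

/-- `lowerPart ⊆ lowerEqPart`. [folklore] -/
theorem lowerPart_le_lowerEqPart (d : ℕ) : lowerPart F w d ≤ lowerEqPart F w d := fun _ hp =>
  mem_lowerEqPart_iff.mpr fun e he => (mem_lowerPart_iff.mp hp e he).le

/-- A "filtered pair": `x` is congruent to the main term `y` modulo lower weight, and `y` has
weight `≤ d`. [folklore] -/
def IsFiltered (w : Fin n × Fin m → ℕ) (x y : MvPolynomial (Fin n × Fin m) F) (d : ℕ) : Prop :=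
  x - y ∈ lowerPart F w d ∧ y ∈ lowerEqPart F w d

/-- Filtered pairs multiply. [folklore] -/
theorem IsFiltered.mul {x y x' y' : MvPolynomial (Fin n × Fin m) F} {d d' : ℕ}
    (h : IsFiltered w x y d) (h' : IsFiltered w x' y' d') : IsFiltered w (x * x') (y * y') (d + d') := by
  refine ⟨?_, mul_mem_lowerEqPart h.2 h'.2⟩
  have hx' : x' ∈ lowerEqPart F w d' := by
    have : x' = (x' - y') + y' := by ring
    rw [this]
    exact add_mem (lowerPart_le_lowerEqPart d' h'.1) h'.2
  have : x * x' - y * y' = (x - y) * x' + y * (x' - y') := by ring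
  rw [this]
  exact add_mem (mul_mem_lowerPart_of_lt_of_le h.1 hx') (mul_mem_lowerPart_of_le_of_lt h.2 h'.1)

/-- `1` is filtered of weight `0`. [folklore] -/
theorem isFiltered_one : IsFiltered w (1 : MvPolynomial (Fin n × Fin m) F) 1 0 := by
  refine ⟨by simp [lowerPart], ?_⟩
  rw [mem_lowerEqPart_iff]
  intro e he
  classical
  rw [MvPolynomial.support_one] at he
  simp only [Finset.mem_singleton] at he
  simp [he]

/-- Products of filtered pairs over a finset. [folklore] -/
theorem IsFiltered.prod {ι : Type*} (s : Finset ι) {x y : ι → MvPolynomial (Fin n × Fin m) F}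
    {d : ι → ℕ} (h : ∀ i ∈ s, IsFiltered w (x i) (y i) (d i)) :
    IsFiltered w (∏ i ∈ s, x i) (∏ i ∈ s, y i) (∑ i ∈ s, d i) := by
  classical
  induction s using Finset.induction_on with
  | empty => simpa using isFiltered_one
  | insert a s ha ih =>
    rw [Finset.prod_insert ha, Finset.prod_insert ha, Finset.sum_insert ha]
    exact (h a (Finset.mem_insert_self a s)).mul (ih fun i hi => h i (Finset.mem_insert_of_mem hi))

/-- Powers of filtered pairs. [folklore] -/
theorem IsFiltered.pow {x y : MvPolynomial (Fin n × Fin m) F} {d : ℕ} (h : IsFiltered w x y d)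
    (k : ℕ) : IsFiltered w (x ^ k) (y ^ k) (k * d) := by
  induction k with
  | zero => simpa using isFiltered_one
  | succ k ih =>
    rw [pow_succ, pow_succ, Nat.succ_mul]
    exact ih.mul h

/-- **Filtered endomorphisms move homogeneous elements only downwards.** If an algebra
endomorphism `θ` of `𝔽[X]` satisfies `θ(X_{ij}) ≡ X_{ij}` modulo monomials of `w`-weight `< w(i,j)`
for every variable, then `θ p ≡ p` modulo weight `< d` for every `p` all of whose monomials have
weight `d`. [folklore] -/
theorem sub_mem_lowerPart_of_filtered
    (θ : MvPolynomial (Fin n × Fin m) F →ₐ[F] MvPolynomial (Fin n × Fin m) F)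
    (hθ : ∀ ij, θ (X ij) - X ij ∈ lowerPart F w (w ij)) {d : ℕ}
    (p : MvPolynomial (Fin n × Fin m) F) (hp : ∀ e ∈ p.support, Finsupp.weight w e = d) :
    θ p - p ∈ lowerPart F w d := by
  classical
  have hX : ∀ ij, IsFiltered w (θ (X ij)) (X ij) (w ij) := by
    intro ij
    refine ⟨hθ ij, mem_lowerEqPart_iff.mpr ?_⟩
    intro e he
    rw [MvPolynomial.support_X, Finset.mem_singleton] at he
    simp [he, Finsupp.weight_single]
  have hmon : ∀ e : Fin n × Fin m →₀ ℕ,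
      IsFiltered w (θ (monomial e 1)) (monomial e 1) (Finsupp.weight w e) := by
    intro e
    have h := IsFiltered.prod (w := w) Finset.univ (x := fun ij => θ (X ij) ^ e ij)
      (y := fun ij => (X ij : MvPolynomial (Fin n × Fin m) F) ^ e ij) (d := fun ij => e ij * w ij)
      (fun ij _ => (hX ij).pow (e ij))
    rw [prod_X_pow_univ] at h
    have hθm : θ (monomial e 1) = ∏ ij, θ (X ij) ^ e ij := by
      rw [← prod_X_pow_univ, map_prod]
      simp only [map_pow]
    have hw : Finsupp.weight w e = ∑ ij, e ij * w ij := by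
      rw [Finsupp.weight_apply, Finsupp.sum_fintype _ _ (by simp)]
      rfl
    rw [hθm, hw]
    exact h
  rw [p.as_sum, map_sum, ← Finset.sum_sub_distrib]
  refine Submodule.sum_mem _ fun e he => ?_
  have hce : monomial e (coeff e p) = coeff e p • monomial e (1 : F) := by
    rw [smul_monomial, smul_eq_mul, mul_one]
  rw [hce, map_smul, ← smul_sub, ← hp e he]
  exact Submodule.smul_mem _ _ (hmon e).1

/-- **Invariance of extremal homogeneous elements.** Under the hypotheses of
`sub_mem_lowerPart_of_filtered`, if moreover no monomial of `θ p` has weight `< d`, then `θ p = p`.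
[folklore] -/
theorem eq_of_filtered (θ : MvPolynomial (Fin n × Fin m) F →ₐ[F] MvPolynomial (Fin n × Fin m) F)
    (hθ : ∀ ij, θ (X ij) - X ij ∈ lowerPart F w (w ij)) {d : ℕ}
    (p : MvPolynomial (Fin n × Fin m) F) (hp : ∀ e ∈ p.support, Finsupp.weight w e = d)
    (hθp : ∀ e ∈ (θ p).support, d ≤ Finsupp.weight w e) : θ p = p := by
  classical
  have hsub := mem_lowerPart_iff.mp (sub_mem_lowerPart_of_filtered θ hθ p hp)
  rw [← sub_eq_zero]
  ext e
  rw [coeff_zero]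
  by_contra hne
  have he : e ∈ (θ p - p).support := mem_support_iff.mpr hne
  have hlt := hsub e he
  rw [coeff_sub] at hne
  have : e ∈ (θ p).support ∨ e ∈ p.support := by
    by_contra h
    push Not at h
    apply hne
    rw [notMem_support_iff.mp h.1, notMem_support_iff.mp h.2, sub_zero]
  rcases this with h | h
  · exact absurd hlt (not_lt.mpr (hθp e h))
  · exact absurd hlt (not_lt.mpr (hp e h).ge)

end Filtered

/-! ### Digits: `b`-adic expansions separate bounded weight vectors -/

section Digits

/-- `b`-adic digit expansions with digits `< b` are unique. [folklore] -/
theorem digits_injective {b : ℕ} (hb : 0 < b) : ∀ {K : ℕ} (c d : Fin K → ℕ),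
    (∀ i, c i < b) → (∀ i, d i < b) →
    ∑ i, c i * b ^ (i : ℕ) = ∑ i, d i * b ^ (i : ℕ) → c = d
  | 0, c, d, _, _, _ => funext fun i => i.elim0
  | K + 1, c, d, hc, hd, h => by
    rw [Fin.sum_univ_succ, Fin.sum_univ_succ] at h
    simp only [Fin.val_zero, pow_zero, mul_one, Fin.val_succ, pow_succ] at h
    have hsum : ∀ f : Fin (K + 1) → ℕ,
        ∑ i : Fin K, f i.succ * (b ^ (i : ℕ) * b) = b * ∑ i : Fin K, f i.succ * b ^ (i : ℕ) := by
      intro f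
      rw [Finset.mul_sum]
      exact Finset.sum_congr rfl fun i _ => by ring
    rw [hsum c, hsum d] at h
    have h0 : c 0 = d 0 := by
      have := congrArg (· % b) h
      simpa [Nat.add_mul_mod_self_left, Nat.mod_eq_of_lt (hc 0), Nat.mod_eq_of_lt (hd 0)] using this
    rw [h0] at h
    have h' : ∑ i : Fin K, c i.succ * b ^ (i : ℕ) = ∑ i : Fin K, d i.succ * b ^ (i : ℕ) :=
      Nat.eq_of_mul_eq_mul_left hb (Nat.add_left_cancel h)
    have htail := digits_injective hb (fun i => c i.succ) (fun i => d i.succ) (fun i => hc _)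
      (fun i => hd _) h'
    funext i
    refine Fin.cases h0 (fun j => ?_) i
    exact congrFun htail j

/-- The weight `∑ μ_i b^i + ∑ ν_j b^{n+j}` of a weight pair as a single digit expansion. [folklore] -/
theorem weight_pow_eq_sum_append (b : ℕ) (e : Fin n × Fin m →₀ ℕ) :
    Finsupp.weight (fun ij : Fin n × Fin m => b ^ (ij.1 : ℕ) + b ^ (n + (ij.2 : ℕ))) e =
      ∑ k : Fin (n + m), Fin.append (rowWt e) (colWt e) k * b ^ (k : ℕ) := by
  rw [weight_add_eq (fun i : Fin n => b ^ (i : ℕ)) (fun j : Fin m => b ^ (n + (j : ℕ))) e,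
    Fin.sum_univ_add]
  simp only [Fin.append_left, Fin.append_right, Fin.val_castAdd, Fin.val_natAdd]

/-- **Digits separate weights.** If all row and column weights of `e` and `e'` are `< b`, and the
`b`-adic weights `∑ μ_i b^i + ∑ ν_j b^{n+j}` agree, then `e` and `e'` have the same row weights and
the same column weights (the `(D+1)`-adic separation trick of the printed proof of Prop. 3.5).
[cite: AndrewsForbes2022, §3.1 (proof of Prop. 3.5)] -/
theorem rowWt_eq_and_colWt_eq_of_weight_eq {b : ℕ} (hb : 0 < b) {e e' : Fin n × Fin m →₀ ℕ}
    (he : ∀ i, rowWt e i < b) (he2 : ∀ j, colWt e j < b)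
    (he' : ∀ i, rowWt e' i < b) (he'2 : ∀ j, colWt e' j < b)
    (h : Finsupp.weight (fun ij : Fin n × Fin m => b ^ (ij.1 : ℕ) + b ^ (n + (ij.2 : ℕ))) e =
      Finsupp.weight (fun ij : Fin n × Fin m => b ^ (ij.1 : ℕ) + b ^ (n + (ij.2 : ℕ))) e') :
    rowWt e = rowWt e' ∧ colWt e = colWt e' := by
  rw [weight_pow_eq_sum_append, weight_pow_eq_sum_append] at h
  have happ := digits_injective hb _ _ (fun k => ?_) (fun k => ?_) h
  · constructor
    · funext i
      have := congrFun happ (Fin.castAdd m i)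
      simpa only [Fin.append_left] using this
    · funext j
      have := congrFun happ (Fin.natAdd n j)
      simpa only [Fin.append_right] using this
  · refine Fin.addCases (fun i => ?_) (fun j => ?_) k
    · simpa only [Fin.append_left] using he i
    · simpa only [Fin.append_right] using he2 j
  · refine Fin.addCases (fun i => ?_) (fun j => ?_) k
    · simpa only [Fin.append_left] using he' i
    · simpa only [Fin.append_right] using he'2 j

end Digits

/-! ### Degree bound for linear substitutions -/

section Degree

variable {S : Type*} [CommRing S] [Algebra F S]

/-- **Linear substitutions do not raise the total degree.** If every entry of `M` is a polynomial
of total degree `≤ 1`, then `deg f(M) ≤ deg f`. [folklore] -/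
theorem totalDegree_ev_le {k l : ℕ} (M : Matrix (Fin n) (Fin m) (MvPolynomial (Fin k × Fin l) F))
    (hM : ∀ i j, (M i j).totalDegree ≤ 1) (p : MvPolynomial (Fin n × Fin m) F) :
    (ev M p).totalDegree ≤ p.totalDegree := by
  classical
  conv_lhs => rw [p.as_sum]
  rw [map_sum]
  refine (MvPolynomial.totalDegree_finsetSum _ _).trans (Finset.sup_le fun e he => ?_)
  rw [ev_monomial, MvPolynomial.algebraMap_eq]
  refine (MvPolynomial.totalDegree_mul _ _).trans ?_
  rw [MvPolynomial.totalDegree_C, zero_add]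
  refine (MvPolynomial.totalDegree_finsetProd _ _).trans ?_
  refine le_trans (Finset.sum_le_sum fun ij _ => (MvPolynomial.totalDegree_pow _ _).trans
    (Nat.mul_le_mul_left _ (hM ij.1 ij.2))) ?_
  simp only [mul_one]
  have : ∑ ij, e ij = e.degree := (Finsupp.degree_eq_sum e).symm
  rw [this]
  exact MvPolynomial.le_totalDegree he

/-- Entries of `A · X · B` (numerical `A`, `B`) are linear forms. [folklore] -/
theorem totalDegree_transl_entry_le (A : Matrix (Fin n) (Fin n) F) (B : Matrix (Fin m) (Fin m) F)
    (i : Fin n) (j : Fin m) :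
    (((A.map C : Matrix (Fin n) (Fin n) (MvPolynomial (Fin n × Fin m) F)) *
      mvPolynomialX (Fin n) (Fin m) F *
      (B.map C : Matrix (Fin m) (Fin m) (MvPolynomial (Fin n × Fin m) F))) i j).totalDegree ≤ 1 := by
  simp only [Matrix.mul_apply, Matrix.map_apply, mvPolynomialX_apply]
  refine (MvPolynomial.totalDegree_finsetSum _ _).trans (Finset.sup_le fun l _ => ?_)
  refine (MvPolynomial.totalDegree_mul _ _).trans ?_
  rw [MvPolynomial.totalDegree_C, add_zero]
  refine (MvPolynomial.totalDegree_finsetSum _ _).trans (Finset.sup_le fun k _ => ?_)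
  refine (MvPolynomial.totalDegree_mul _ _).trans ?_
  rw [MvPolynomial.totalDegree_C, zero_add]
  exact (MvPolynomial.totalDegree_X _).le

/-- Translates do not raise the total degree. [folklore] -/
theorem totalDegree_transl_le (A : Matrix (Fin n) (Fin n) F) (B : Matrix (Fin m) (Fin m) F)
    (p : MvPolynomial (Fin n × Fin m) F) : (transl A B p).totalDegree ≤ p.totalDegree := by
  rw [transl_apply]
  exact totalDegree_ev_le _ (totalDegree_transl_entry_le A B) p

end Degree

/-! ### From `𝔽`-points to points in any `𝔽`-algebra -/

section Generic

/-- **Unitriangular invariance is a polynomial identity.** Suppose `f(L X U) = f(X)` in `𝔽[X]` for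
all lower unitriangular `L ∈ Mat_n(𝔽)` and upper unitriangular `U ∈ Mat_m(𝔽)`, `𝔽` an infinite
field. Then `f(L M U) = f(M)` for unitriangular `L, U` and arbitrary `M` with entries in any
commutative `𝔽`-algebra `S` (both sides are specialisations of one polynomial identity in the
entries of `L, X, U`, which holds at all `𝔽`-points, hence identically by `MvPolynomial.funext`).
[folklore] -/
theorem ev_lower_mul_mul_upper_eq_of_forall [Infinite F] (f : MvPolynomial (Fin n × Fin m) F)
    (hf : ∀ (L : Matrix (Fin n) (Fin n) F) (U : Matrix (Fin m) (Fin m) F),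
      L.BlockTriangular OrderDual.toDual → (∀ i, L i i = 1) →
      U.BlockTriangular id → (∀ i, U i i = 1) →
      ev ((L.map C : Matrix (Fin n) (Fin n) (MvPolynomial (Fin n × Fin m) F)) *
        mvPolynomialX (Fin n) (Fin m) F *
        (U.map C : Matrix (Fin m) (Fin m) (MvPolynomial (Fin n × Fin m) F))) f = f)
    {S : Type*} [CommRing S] [Algebra F S]
    (L : Matrix (Fin n) (Fin n) S) (U : Matrix (Fin m) (Fin m) S)
    (hL : L.BlockTriangular OrderDual.toDual) (hLd : ∀ i, L i i = 1)
    (hU : U.BlockTriangular id) (hUd : ∀ i, U i i = 1) (M : Matrix (Fin n) (Fin m) S) :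
    ev (L * M * U) f = ev M f := by
  classical
  -- one polynomial ring for the entries of `L`, `U` and `X`
  let V := (Fin n × Fin n) ⊕ ((Fin m × Fin m) ⊕ (Fin n × Fin m))
  let P := MvPolynomial V F
  let Λ : Matrix (Fin n) (Fin n) P := Matrix.of fun i k =>
    if k < i then X (Sum.inl (i, k)) else if k = i then 1 else 0
  let Υ : Matrix (Fin m) (Fin m) P := Matrix.of fun l j =>
    if l < j then X (Sum.inr (Sum.inl (l, j))) else if l = j then 1 else 0
  let Y : Matrix (Fin n) (Fin m) P := Matrix.of fun i j => X (Sum.inr (Sum.inr (i, j)))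
  let G : P := ev (Λ * Y * Υ) f - ev Y f
  -- specialisations of the generic unitriangular matrices at `𝔽`-points
  have hΛ : ∀ ψ : P →ₐ[F] F,
      (Λ.map ψ).BlockTriangular OrderDual.toDual ∧ (∀ i, Λ.map ψ i i = 1) := by
    intro ψ
    constructor
    · intro i k hik
      have hik' : i < k := hik
      simp only [Λ, Matrix.map_apply, Matrix.of_apply, if_neg (not_lt.mpr hik'.le), if_neg hik'.ne',
        map_zero]
    · intro i
      simp [Λ]
  have hΥ : ∀ ψ : P →ₐ[F] F,
      (Υ.map ψ).BlockTriangular id ∧ (∀ i, Υ.map ψ i i = 1) := by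
    intro ψ
    constructor
    · intro l j hlj
      have hlj' : j < l := hlj
      simp only [Υ, Matrix.map_apply, Matrix.of_apply, if_neg (not_lt.mpr hlj'.le), if_neg hlj'.ne',
        map_zero]
    · intro i
      simp [Υ]
  -- Step 1: `G` vanishes at every `𝔽`-point
  have hG0 : ∀ x : V → F, MvPolynomial.aeval x G = 0 := by
    intro x
    simp only [G, map_sub, map_ev]
    rw [map_mul_mul]
    set Lx := Λ.map (MvPolynomial.aeval x : P →ₐ[F] F) with hLx
    set Ux := Υ.map (MvPolynomial.aeval x : P →ₐ[F] F) with hUx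
    set Yx := Y.map (MvPolynomial.aeval x : P →ₐ[F] F) with hYx
    have hpoly := hf Lx Ux (hΛ _).1 (hΛ _).2 (hΥ _).1 (hΥ _).2
    -- evaluate the polynomial identity at `Yx`
    have := congrArg (ev Yx) hpoly
    rw [ev_ev, map_mul_mul, map_C_map_ev, map_C_map_ev, mvPolynomialX_map_ev] at this
    simpa [Algebra.algebraMap_self, Matrix.map_id] using sub_eq_zero.mpr this
  -- Step 2: hence `G = 0`
  have hG : G = 0 := MvPolynomial.funext fun x => by
    rw [map_zero]
    exact hG0 x
  -- Step 3: specialise to the given `L`, `U`, `M`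
  let pt : V → S := Sum.elim (fun ik => L ik.1 ik.2) (Sum.elim (fun lj => U lj.1 lj.2) fun ij => M ij.1 ij.2)
  have hΛpt : Λ.map (MvPolynomial.aeval pt : P →ₐ[F] S) = L := by
    ext i k
    simp only [Λ, Matrix.map_apply, Matrix.of_apply]
    by_cases hki : k < i
    · simp [hki, pt]
    · by_cases hki' : k = i
      · subst hki'
        simp [hLd]
      · have hik : i < k := lt_of_le_of_ne (not_lt.mp hki) (Ne.symm hki')
        rw [if_neg hki, if_neg hki', map_zero]
        exact (hL (show OrderDual.toDual k < OrderDual.toDual i from hik)).symm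
  have hΥpt : Υ.map (MvPolynomial.aeval pt : P →ₐ[F] S) = U := by
    ext l j
    simp only [Υ, Matrix.map_apply, Matrix.of_apply]
    by_cases hlj : l < j
    · simp [hlj, pt]
    · by_cases hlj' : l = j
      · subst hlj'
        simp [hUd]
      · have hjl : j < l := lt_of_le_of_ne (not_lt.mp hlj) (Ne.symm hlj')
        rw [if_neg hlj, if_neg hlj', map_zero]
        exact (hU (show id j < id l from hjl)).symm
  have hYpt : Y.map (MvPolynomial.aeval pt : P →ₐ[F] S) = M := by
    ext i j
    simp [Y, pt]
  have := congrArg (MvPolynomial.aeval pt : P →ₐ[F] S) hG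
  rw [map_zero] at this
  simp only [G, map_sub, map_ev] at this
  rw [map_mul_mul, hΛpt, hΥpt, hYpt] at this
  exact sub_eq_zero.mp this

end Generic

end Literature.Computability.AlgebraicComplexity.AndrewsForbes
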